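import Summits.BirchSwinnertonDyer.Rank1Residual.ManinAdditive.ConwayCut
import Summits.BirchSwinnertonDyer.Rank1Residual.ManinAdditive.RamanujanCut
import Literature.NumberTheory.DiophantineGeometry.TameAdditiveTypesAtTwoProofs
import Literature.NumberTheory.EllipticCurves.Tamagawa
import Literature.NumberTheory.EllipticCurves.MordellWeil
import HarnessLib
import HarnessLib.Audit.Tags

/-!
# The Conway cut at `2` beyond the all-rational levels: Kodaira-type laws E-desc-40 / 41 / 44 / 44′ / 46 / 47 and the
# derived tame law E-desc-38 (desc g6 «ENGINE MS-0», MEMO-desc §23 / §23.9; typing ask T-desc-10 rev 5) —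
# cell `bsd-f2-manin` (D-0131 (3) frontier: the Manin constant at additive primes)

HONEST FRAMING.  LENS = descent / E-blind modular symbols (planner `bsd-f2-manin-desc`, g6; HOME
`run/shared/lean/pub/bsd-f2-manin/MEMO-desc.md` §23, censuses HOME/desc/MS0-CONWAY-rows-g6.tsv (399 optimal newforms with
`4 ∣ N ≤ 612`) + MS0-CONWAY-rows-g6-oos.tsv (19 out of sample at N = 664, 916, 944)).  Source: HOME/desc/Sketch-desc-g6.lean
rev 5 sha16 **81eaae2400f26838** (farm rc 0), namespace `…ManinAdditive.DescG6` ↦ the namespace of the landed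
`ConwayCut.lean` (`…ManinAdditive.ConwayCut`, whose first cluster — `conwayStableLattice`, `HasRationalTwoTorsion`,
`HasTwoTorsionInIdentityComponentAtTwo`, E-desc-28♯/31/32, the GIVEN row `IsConwayNeronAtTwo`, `ConwayDepthTransfer` and
its chain — this sibling file imports and does NOT re-declare); rows VERBATIM except TWO refuter-1 typing actions (§R57,
2026-08-28T10:26:53Z, addressed to «-ty and -desc»), both folded here and flagged at the declaration:
(F1) **E-desc-38 `TameConwayKodairaLaw` is NOT an independent law** — kernel `RefAudit65.tameKodairaLaw_of_laws :
T1 → T2 → E-40 → E-41 → E-31 → E-38` — so it is filed as a plain `def` (DERIVED row, not a candidate) with that theorem,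
the Tate fact T1 («`f₂ = 2 ⇒ v₂(Δ_min) ∈ {4, 8}`») DISCHARGED from the Literature theorem
`padicValInt_two_minimalDiscriminantInt_of_four_dvd_conductorNorm` (typer, `TameAdditiveTypesAtTwoProofs`) and T2 («tame
IV* with rational 2-torsion ⇒ a rational 2-torsion point in `E⁰(ℚ₂)`») kept as an explicit hypothesis;
(F2) **`IsResidualAtTwo` REPAIRED** to `¬ E⁰-torsion ∧ (I₀* ∨ (starred ∧ rational 2-torsion))` — desc's rev-5 typing
`I₀* ∨ (starred ∧ 2-torsion ∧ ¬ E⁰)` lacked the `¬ E⁰` clause in its I₀* branch although the census filter, the prose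
(MEMO-desc §23 S4) and `IsIstarResidualAtTwo` have it (kernel RB65.2: the unrepaired trio E-31 ∧ E-44/44′/46 silently
predicted «no optimal I₀*-at-2 curve with an `E⁰`-rational 2-torsion point has positive rank or a Tamagawa excess» —
true ≤ 130 000 on 21 curves, but not what desc meant).  `HasPointOfInfiniteOrder` is imported from the landed
`RamanujanCut.lean` second cluster (same text).  The chain theorems thread `h4 : 4 ∣ N` into the landed
`not_two_dvd_maninConstant_of_conwayDepth` (refuter-1 §R53 rec. 1, as in `ConwayCut.lean`).

THE ROWS (σ₂ := ord₂ deg φ − ord₂ [e_f S^G : ℤ f], the CONWAY DEFECT of the optimal `f`-line).  PARTITION of the 399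
optimal curves with `4 ∣ N ≤ 612` (refuter-1 engine 2 reproduces every E-facing column, 0 mismatches): unstarred 178
(σ₂ = 0, **E-desc-40**) + starred with `E⁰`-torsion 11 (σ₂ = 0, E-desc-31, landed) + exceptional star (IV*/III*/II*)
without `E⁰`-torsion 93 (σ₂ = 1, **E-desc-47**) + Iₙ* (n ≥ 1) without rational 2-torsion 37 (σ₂ = 1, **E-desc-41**) +
Iₙ*-residual 80 (`IsIstarResidualAtTwo`; 11 full : 69 defect).  On the residual class two GLOBAL data force the defect
one-sidedly: a point of infinite order (**E-desc-44**, 33/33; **44′** in `mordellWeilRank` currency) and a 2-adic excess of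
the Tamagawa product over the torsion order (**E-desc-46**, 58/58); undecided core after the repair: 39 rank-0 rows.
Out of sample 19/19 (three rank-2 additive curves 664a1, 916c1, 944e1 included: the defect does not stack with the rank).

REFUTER VERDICTS: **REF1 §R57 = R-desc-11** (report HOME/ref1/R57-ref1-desc-g6.md b201cde6d2933293; kernel
HOME/ref1-C65-desc-g6-audit.lean c7af850baac8c93a, `RefAudit65`; BC7 probes 10/10 CLEAN; engine 2 HOME/ref1/R57-e57desc.py
→ .out bb20362ea3943b84): E-desc-40, 41, 44, 44′, 46, 47 **SURVIVE** (40/41/47 census LAWS not in print; 44/46 = VARIANTS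
of Watkins' refined conjecture «#Sel₂ ∣ deg φ … involving the Atkin–Lehner subgroup through which Φ factors» after the
`⟨w, t⟩` quotient [Watkins 2002 §4; Dummigan–Krishnamoorthy 2013 exclude `4 ∣ N`]); E-desc-38 REDUNDANT (F1).  REF2
placement pending.  bears_on: stmt-BirchSwinnertonDyer-22967 (C2, the Manin constant at `2`).  Beyond-print theorem: no.
BSD is not proved by this; Manin's conjecture is not proved by this.
-/

set_option autoImplicit false

noncomputable section

open scoped MatrixGroups ModularForm

open CongruenceSubgroup WeierstrassCurve Literature.NumberTheory.EllipticCurves.ModularForms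
  Literature.NumberTheory.DiophantineGeometry
open Summit.BirchSwinnertonDyer.Rank1Residual.ManinAdditive.RamanujanCut (HasPointOfInfiniteOrder)

namespace Summit.BirchSwinnertonDyer.Rank1Residual.ManinAdditive.ConwayCut

section LawsG6

open scoped Classical

/-! ### §1. Elementary Kodaira typing at `2` by valuations (desc g6 VERBATIM, Sketch-desc-g6.lean rev 5 :221–233) -/

/-- Kodaira type IV* at `2` on the tame cell `v₂(N) = 2` (there the type is IV iff `v₂(Δ) = 4`, IV* iff `v₂(Δ) = 8`). -/
def IsTypeFourStarAtTwoTame (W : WeierstrassCurve ℚ) : Prop :=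
  padicValNat 2 (W.conductorNorm ℤ) = 2 ∧ padicValRat 2 W.Δ = 8

/-- Starred Kodaira type at `2` (I₀*, Iₙ*, IV*, III*, II*): at least five components, `v₂(Δ) ≥ v₂(N) + 4`
(for a globally minimal `W` with `4 ∣ N`). -/
def IsStarredAtTwo (W : WeierstrassCurve ℚ) : Prop :=
  ((padicValNat 2 (W.conductorNorm ℤ) + 4 : ℕ) : ℤ) ≤ padicValRat 2 W.Δ

/-- Kodaira type I₀* at `2`: exactly five components, `v₂(Δ) = v₂(N) + 4`. -/
def IsTypeIZeroStarAtTwo (W : WeierstrassCurve ℚ) : Prop :=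
  padicValRat 2 W.Δ = ((padicValNat 2 (W.conductorNorm ℤ) + 4 : ℕ) : ℤ)

/-- The RESIDUAL CLASS at `2` (for a globally minimal `W` with `4 ∣ N`): NO rational 2-torsion point in the identity
component `E⁰(ℚ₂)`, and Kodaira I₀* at `2` or a starred type with non-trivial rational 2-torsion (then through `Φ₂`).
**REPAIRED per refuter-1 §R57 (F2)**: desc's rev-5 text read `I₀* ∨ (starred ∧ 2-torsion ∧ ¬ E⁰)`; the `¬ E⁰` clause now
governs both branches, as in the census filter and MEMO-desc §23 S4 (typed class 103 → prose class 98 rows ≤ 612; the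
five moved rows 48a1, 80a1, 80b1, 208c1, 464e1 are I₀* with `E⁰`-torsion, σ₂ = 0, decided by E-desc-31).  On its
complement σ₂ is decided by E-desc-40 / 41 / 31 / 47; on it, MS-0 shows σ₂ is NOT a function of `(E ×_ℚ ℚ₂, torsion
position)`: 56a1 ≅ 392a1 over `ℚ₂` (392a1 = 56a1 ⊗ χ₋₇), both I₁*, `c₂ = 4`, `ℤ/4` through Φ, σ₂ = 0 resp. 1. -/
def IsResidualAtTwo (W : WeierstrassCurve ℚ) : Prop :=
  ¬ HasTwoTorsionInIdentityComponentAtTwo W ∧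
    (IsTypeIZeroStarAtTwo W ∨ (IsStarredAtTwo W ∧ HasRationalTwoTorsion W))

/-- The finite place of `ℚ` at `2`, as a height-one prime of `ℤ` (the indexing type of `WeierstrassCurve.kodairaSymbolAt`
for curves over `ℚ`; same pattern as `…ManinAdditive.ComponentExponentDegreeLaw`). (desc g6 VERBATIM, :801–802.) -/
def placeTwo : IsDedekindDomain.HeightOneSpectrum ℤ :=
  (Rat.HeightOneSpectrum.primesEquiv (R := ℤ)).symm ⟨2, Nat.prime_two⟩

/-- EXCEPTIONAL STAR at `2`: Kodaira symbol IV*, III* or II* (Tate's algorithm over `ℤ₂`, tree decl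
`WeierstrassCurve.kodairaSymbolAt`) — the starred fibres whose geometric component group is cyclic of order `3, 2, 1`;
the other starred fibres, I₀* and Iₙ*, have component group of order 4. (desc g6 VERBATIM, :807–808.) -/
def IsExceptionalStarAtTwo (W : WeierstrassCurve ℚ) : Prop :=
  W.kodairaSymbolAt placeTwo = .IVstar ∨ W.kodairaSymbolAt placeTwo = .IIIstar ∨ W.kodairaSymbolAt placeTwo = .IIstar

/-- The Iₙ*-RESIDUAL class at `2` (rev 5; 80 optimal curves at `4 ∣ N ≤ 612`, 11 of full Conway depth, 69 of defect one):
Kodaira Iₙ* (n ≥ 0) at `2`, no rational 2-torsion point in `E⁰(ℚ₂)`, and either n = 0 or some rational 2-torsion point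
(then necessarily through Φ₂).  Everything outside this class is decided by E-desc-31/40/41/47. (desc g6 VERBATIM, :813–815.) -/
def IsIstarResidualAtTwo (W : WeierstrassCurve ℚ) : Prop :=
  (∃ n : ℕ, W.kodairaSymbolAt placeTwo = .Istar n) ∧ ¬ HasTwoTorsionInIdentityComponentAtTwo W ∧
    (W.kodairaSymbolAt placeTwo = .Istar 0 ∨ HasRationalTwoTorsion W)

/-! ### §2. The candidate laws (nothing asserted) -/

/-- **Candidate E-desc-40 `UnstarredConwayFullLaw` (cell bsd-f2-manin, desc g6 MEMO-desc §23; nothing asserted; every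
`4 ∣ N`; MS-0 census 178/178 at `4 ∣ N ≤ 612` — II 36, III 73, IV 69, every `v₂(N) ∈ {2,…,8}`, both ranks; out of sample
9/9 incl. the rank-2 curve 916c1): an UNSTARRED fibre at `2` forces FULL Conway depth on the optimal `f`-line,
`ord₂ [e_f S^G : ℤ f] = ord₂ deg φ`.**  Modulo the GIVEN row (`IsConwayNeronAtTwo`) and `ConwayDepthTransfer` this yields
`2 ∤ c_E` and Lie-saturation at `2` for the whole unstarred class with no table input
(`not_two_dvd_maninConstant_of_unstarred`).  Why it might fail (desc): an unstarred optimal curve at a level `2^8 ∣ N` or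
with a deep odd square factor where a second, non-local congruence is cut by `⟨w_Q, t⟩`.  VERBATIM :247–256.  REF1 §R57:
SURVIVES (LAW, not in print).
[cite: CesnaviciusNeururerSaha2023, Thm. 1.2 and p. 4 L10–16 (shape only: Manin at 2 via the Néron lattice; the full-depth law on the unstarred class is the cell's row E-desc-40, NOT in print — MEMO-desc §23)] -/
@[conjecture]
def UnstarredConwayFullLaw : Prop :=
  ∀ (W : WeierstrassCurve ℚ) [W.IsElliptic] [W.IsGloballyMinimal] [NeZero (W.conductorNorm ℤ)]
    (D : ModularParametrizationData W (W.conductorNorm ℤ)),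
    (∀ z ∈ D.L.lattice, ∃ w ∈ periodLattice D.f, z = D.c * w) →
    (∀ (W' : WeierstrassCurve ℚ) [W'.IsElliptic]
        (D' : ModularParametrizationData W' (W.conductorNorm ℤ)),
        D'.f = D.f → D.modularDegree ≤ D'.modularDegree) →
    4 ∣ W.conductorNorm ℤ → ¬ IsStarredAtTwo W →
      padicValNat 2 (lineIndex (conwayStableLattice (W.conductorNorm ℤ)) D.f) = padicValNat 2 D.modularDegree

/-- **Candidate E-desc-41 `StarredConwayDefectLaw` (cell bsd-f2-manin, desc g6; nothing asserted; every `4 ∣ N`; MS-0 census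
112/112 at `4 ∣ N ≤ 612` — IV* 47, I₁* 19, Iₙ* (n ≥ 2) 18, III* 13, II* 15; I₀* excluded on purpose (416a1, 464d1, 464f1,
608c1 are torsion-free I₀* with σ₂ = 0); out of sample 7/7 incl. the rank-2 curves 664a1, 944e1): a starred, non-I₀* fibre
at `2` and `E(ℚ)[2] = 0` force Conway defect EXACTLY ONE, `ord₂ [e_f S^G : ℤ f] + 1 = ord₂ deg φ`**; with `c_E` odd this
certifies that `E → J₀(N)` is NOT Lie-saturated at `2`.  Why it might fail (desc): a potentially multiplicative Iₙ* whose
twist partner sits at a level where `t` acts trivially on the packet, or CM `j = 1728` (32a1, 64a1 carry 2-torsion).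
VERBATIM :270–279.  REF1 §R57: SURVIVES (LAW, not in print).
[cite: CesnaviciusNeururerSaha2023, Thm. 1.2 and p. 4 L10–16 (shape only; the exact-defect law is the cell's row E-desc-41, NOT in print — MEMO-desc §23)] -/
@[conjecture]
def StarredConwayDefectLaw : Prop :=
  ∀ (W : WeierstrassCurve ℚ) [W.IsElliptic] [W.IsGloballyMinimal] [NeZero (W.conductorNorm ℤ)]
    (D : ModularParametrizationData W (W.conductorNorm ℤ)),
    (∀ z ∈ D.L.lattice, ∃ w ∈ periodLattice D.f, z = D.c * w) →
    (∀ (W' : WeierstrassCurve ℚ) [W'.IsElliptic]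
        (D' : ModularParametrizationData W' (W.conductorNorm ℤ)),
        D'.f = D.f → D.modularDegree ≤ D'.modularDegree) →
    4 ∣ W.conductorNorm ℤ → IsStarredAtTwo W → ¬ IsTypeIZeroStarAtTwo W → ¬ HasRationalTwoTorsion W →
      padicValNat 2 (lineIndex (conwayStableLattice (W.conductorNorm ℤ)) D.f) + 1 = padicValNat 2 D.modularDegree

/-- **Candidate E-desc-44 `ResidualRankDefectLawAtTwo` (cell bsd-f2-manin, desc g6; nothing asserted; one-sided LAW on the
residual class at `2`; MS-0 census `4 ∣ N ≤ 612`: every residual-class optimal curve of analytic rank 1 has σ₂ = 1 (33/33),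
every residual-class curve with σ₂ = 0 has rank 0; out of sample 944a1, 944b1): a point of infinite order forces the
Conway defect, `ord₂ [e_f S^G : ℤ f] + 1 = ord₂ deg φ`** — the first GLOBAL datum seen to act on the residual class (cf.
Watkins' `2^{rank} ∣ deg φ`, here AFTER the `⟨w_Q, t⟩`-automorphic part has been divided out).  Why it might fail (desc): a
rank-1 residual curve beyond 612 whose rank factor of `deg φ` is already inside `r_G`; rank ≥ 2 untested in range.
VERBATIM :329–339 over the REPAIRED `IsResidualAtTwo` (F2).  REF1 §R57: SURVIVES (variant of Watkins' refined conjecture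
after the `⟨w, t⟩` quotient).
[cite: Watkins2002, §4 (shape only: `2^r ∣ deg φ` and its refinement through the Atkin–Lehner quotient; the Conway-index form is the cell's row E-desc-44, NOT in print — MEMO-desc §23)] -/
@[conjecture]
def ResidualRankDefectLawAtTwo : Prop :=
  ∀ (W : WeierstrassCurve ℚ) [W.IsElliptic] [W.IsGloballyMinimal] [NeZero (W.conductorNorm ℤ)]
    (D : ModularParametrizationData W (W.conductorNorm ℤ)),
    (∀ z ∈ D.L.lattice, ∃ w ∈ periodLattice D.f, z = D.c * w) →
    (∀ (W' : WeierstrassCurve ℚ) [W'.IsElliptic]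
        (D' : ModularParametrizationData W' (W.conductorNorm ℤ)),
        D'.f = D.f → D.modularDegree ≤ D'.modularDegree) →
    4 ∣ W.conductorNorm ℤ → IsResidualAtTwo W → HasPointOfInfiniteOrder W →
      padicValNat 2 (lineIndex (conwayStableLattice (W.conductorNorm ℤ)) D.f) + 1 =
        padicValNat 2 D.modularDegree

/-- **E-desc-44′ `ResidualRankDefectLawAtTwo'`**: E-desc-44 in the tree's Mordell–Weil currency
(`WeierstrassCurve.mordellWeilRank`); over `ℚ` the two hypotheses are equivalent by the Mordell–Weil theorem (not proved
here).  VERBATIM :770–779 over the REPAIRED `IsResidualAtTwo`.  REF1 §R57: SURVIVES. (nothing asserted)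
[cite: Watkins2002, §4 (shape only, as for E-desc-44)] -/
@[conjecture]
def ResidualRankDefectLawAtTwo' : Prop :=
  ∀ (W : WeierstrassCurve ℚ) [W.IsElliptic] [W.IsGloballyMinimal] [NeZero (W.conductorNorm ℤ)]
    (D : ModularParametrizationData W (W.conductorNorm ℤ)),
    (∀ z ∈ D.L.lattice, ∃ w ∈ periodLattice D.f, z = D.c * w) →
    (∀ (W' : WeierstrassCurve ℚ) [W'.IsElliptic]
        (D' : ModularParametrizationData W' (W.conductorNorm ℤ)),
        D'.f = D.f → D.modularDegree ≤ D'.modularDegree) →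
    4 ∣ W.conductorNorm ℤ → IsResidualAtTwo W → 0 < W.mordellWeilRank →
      padicValNat 2 (lineIndex (conwayStableLattice (W.conductorNorm ℤ)) D.f) + 1 =
        padicValNat 2 D.modularDegree

/-- **Candidate E-desc-46 `ResidualTamagawaDefectLawAtTwo` (cell bsd-f2-manin, desc g6 addendum MEMO-desc §23.9; nothing
asserted; one-sided LAW on the residual class at `2`; MS-0 census `4 ∣ N ≤ 612`: all 58 residual-class optimal curves with
`v₂(∏_q c_q) > v₂(#E(ℚ)_tors)` have Conway defect one, in both ranks): on the residual class a 2-adic excess of the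
Tamagawa product `WeierstrassCurve.tamagawaProduct` over the torsion order `WeierstrassCurve.torsionOrder` forces
`ord₂ [e_f S^G : ℤ f] + 1 = ord₂ deg φ`.**  Read through BSD, E-desc-44 and E-desc-46 both say: a 2-adic contribution to
`L(E,1)/Ω` or to the 2-Selmer group not carried by the rational torsion shows up as a congruence of `f` modulo 2 OUTSIDE
the `⟨w_Q, t⟩`-stable lattice.  Why it might fail (desc): a residual-class curve with an even `c_q` at an odd prime of
NON-split type and full depth; a I₀* curve with `c₂ = 2`, trivial torsion and σ₂ = 0 (none ≤ 612).  VERBATIM :756–768 over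
the REPAIRED `IsResidualAtTwo`.  REF1 §R57: SURVIVES (variant of Watkins' refined conjecture; off the residual class the
Tamagawa reading is void — 68 unstarred curves have the excess and σ₂ = 0).
[cite: Watkins2002, §4 (shape only: Selmer/Tamagawa divisibility of deg φ; the Conway-index form on the residual class is the cell's row E-desc-46, NOT in print — MEMO-desc §23.9)] -/
@[conjecture]
def ResidualTamagawaDefectLawAtTwo : Prop :=
  ∀ (W : WeierstrassCurve ℚ) [W.IsElliptic] [W.IsGloballyMinimal] [NeZero (W.conductorNorm ℤ)]
    (D : ModularParametrizationData W (W.conductorNorm ℤ)),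
    (∀ z ∈ D.L.lattice, ∃ w ∈ periodLattice D.f, z = D.c * w) →
    (∀ (W' : WeierstrassCurve ℚ) [W'.IsElliptic]
        (D' : ModularParametrizationData W' (W.conductorNorm ℤ)),
        D'.f = D.f → D.modularDegree ≤ D'.modularDegree) →
    4 ∣ W.conductorNorm ℤ → IsResidualAtTwo W →
    padicValNat 2 W.torsionOrder < padicValNat 2 W.tamagawaProduct →
      padicValNat 2 (lineIndex (conwayStableLattice (W.conductorNorm ℤ)) D.f) + 1 =
        padicValNat 2 D.modularDegree

/-- **Candidate E-desc-47 `ExceptionalStarDefectLawAtTwo` (cell bsd-f2-manin, desc g6 addendum; nothing asserted; LAW, the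
`p = 2` twin of E-desc-43; MS-0 census `4 ∣ N ≤ 612`: every optimal curve of Kodaira type IV*, III* or II* at `2` WITHOUT a
rational 2-torsion point in `E⁰(ℚ₂)` has Conway defect exactly one — 93/93: IV* 47, III* 31 (13 torsion-free, 18 with
`ℤ/2 ⊂ Φ₂(ℚ₂)`), II* 15; the only exceptional-star curves of full depth are the four tame IV* curves 20a1, 52a1, 116c1, 212b1
whose 2-torsion meets `E⁰`): `ord₂ [e_f S^G : ℤ f] + 1 = ord₂ deg φ`.**  With `c_E` odd: the optimal parametrisation of an
exceptional-star curve is never Lie-saturated at `2` unless a rational 2-torsion point reduces into `E⁰`.  Why it might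
fail (desc): a III* curve with `ℤ/2 ⊂ Φ` at `2^7 ∣ N` or `2^8 ∣ N` beyond 612 behaving like the small Iₙ* exceptions
(32a1, 64a1); a II* curve with non-trivial 2-torsion (none in range).  VERBATIM :826–835.  REF1 §R57: SURVIVES (LAW, not
in print).
[cite: Papadopoulos1993, Table IV (p = 2) (shape only: the Kodaira–Néron classification at 2 that types the class; the defect law is the cell's row E-desc-47, NOT in print — MEMO-desc §23.9)] -/
@[conjecture]
def ExceptionalStarDefectLawAtTwo : Prop :=
  ∀ (W : WeierstrassCurve ℚ) [W.IsElliptic] [W.IsGloballyMinimal] [NeZero (W.conductorNorm ℤ)]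
    (D : ModularParametrizationData W (W.conductorNorm ℤ)),
    (∀ z ∈ D.L.lattice, ∃ w ∈ periodLattice D.f, z = D.c * w) →
    (∀ (W' : WeierstrassCurve ℚ) [W'.IsElliptic]
        (D' : ModularParametrizationData W' (W.conductorNorm ℤ)),
        D'.f = D.f → D.modularDegree ≤ D'.modularDegree) →
    4 ∣ W.conductorNorm ℤ → IsExceptionalStarAtTwo W → ¬ HasTwoTorsionInIdentityComponentAtTwo W →
      padicValNat 2 (lineIndex (conwayStableLattice (W.conductorNorm ℤ)) D.f) + 1 =
        padicValNat 2 D.modularDegree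

/-! ### §3. E-desc-38 as a DERIVED row (refuter-1 §R57 F1), with the Tate fact T1 discharged -/

/-- **E-desc-38 `TameConwayKodairaLaw` — DERIVED ROW, not a candidate** (refuter-1 §R57 (F1): it follows from E-desc-40 ∧
E-desc-41 ∧ E-desc-31 modulo two Tate facts at `2`, theorem `tameConwayKodairaLaw_of_laws` below; tame cell `4 ∥ N`; MS-0
census 120/120 — IV without (27) / with (42) rational 2-torsion σ₂ = 0, IV* without rational 2-torsion (47) σ₂ = 1, IV* with
rational 2-torsion (4: 20a1, 52a1, 116c1, 212b1, all of odd modular degree) σ₂ = 0):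
`ord₂ [e_f S^G : ℤ f] + [IV* at 2 ∧ E(ℚ)[2] = 0] = ord₂ deg φ`.  VERBATIM :241–251 (as a plain definition). -/
def TameConwayKodairaLaw : Prop :=
  ∀ (W : WeierstrassCurve ℚ) [W.IsElliptic] [W.IsGloballyMinimal] [NeZero (W.conductorNorm ℤ)]
    (D : ModularParametrizationData W (W.conductorNorm ℤ)),
    (∀ z ∈ D.L.lattice, ∃ w ∈ periodLattice D.f, z = D.c * w) →
    (∀ (W' : WeierstrassCurve ℚ) [W'.IsElliptic]
        (D' : ModularParametrizationData W' (W.conductorNorm ℤ)),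
        D'.f = D.f → D.modularDegree ≤ D'.modularDegree) →
    padicValNat 2 (W.conductorNorm ℤ) = 2 →
      padicValNat 2 (lineIndex (conwayStableLattice (W.conductorNorm ℤ)) D.f) +
        (if IsTypeFourStarAtTwoTame W ∧ ¬ HasRationalTwoTorsion W then 1 else 0) =
          padicValNat 2 D.modularDegree

/-- **T1 (Tate at `2`, DISCHARGED): `4 ∥ N_E ⇒ v₂(Δ) ∈ {4, 8}` on a globally minimal model** — tame inertia at `2` has
order 3, types IV / IV* only.  From the Literature theorem `padicValInt_two_minimalDiscriminantInt_of_four_dvd_conductorNorm`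
(`TameAdditiveTypesAtTwoProofs`) and `cast_minimalDiscriminantInt`. (PROVED.)
[cite: SilvermanATAEC1994, IV.9.4 and Table 4.1] -/
theorem padicValRat_two_Δ_of_padicValNat_conductorNorm_eq_two (W : WeierstrassCurve ℚ) [W.IsElliptic]
    [W.IsGloballyMinimal] (h2 : padicValNat 2 (W.conductorNorm ℤ) = 2) :
    padicValRat 2 W.Δ = 4 ∨ padicValRat 2 W.Δ = 8 := by
  have hN : W.conductorNorm ℤ ≠ 0 := (conductorNorm_pos_holds W).ne'
  have h4 : 2 ^ 2 ∣ W.conductorNorm ℤ := by rw [padicValNat_dvd_iff_le hN]; omega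
  have h8 : ¬ 2 ^ 3 ∣ W.conductorNorm ℤ := by rw [padicValNat_dvd_iff_le hN]; omega
  rw [← cast_minimalDiscriminantInt W, padicValRat.of_int]
  rcases W.padicValInt_two_minimalDiscriminantInt_of_four_dvd_conductorNorm h4 h8 with h | h
  · exact Or.inl (by rw [h]; rfl)
  · exact Or.inr (by rw [h]; rfl)

/-- **E-desc-38 is a COROLLARY of E-desc-40 ∧ E-desc-41 ∧ E-desc-31** modulo the Tate fact (T2) «a tame IV* curve with
rational 2-torsion has a rational 2-torsion point in `E⁰(ℚ₂)`» (`Φ₂ ≅ ℤ/3` has no 2-torsion and rational 2-torsion points of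
an additive minimal model at `2` are integral), kept as a hypothesis; (T1) is discharged above.  Refuter-1 kernel
`RefAudit65.tameKodairaLaw_of_laws` VERBATIM up to the T1 discharge (PROVED): the g6 law set at `2` is
{31, 40, 41, 44/44′, 46, 47} + E-desc-32; E-desc-38 adds nothing. -/
theorem tameConwayKodairaLaw_of_laws
    (T2 : ∀ (W : WeierstrassCurve ℚ) [W.IsElliptic] [W.IsGloballyMinimal],
        IsTypeFourStarAtTwoTame W → HasRationalTwoTorsion W → HasTwoTorsionInIdentityComponentAtTwo W)
    (h40 : UnstarredConwayFullLaw) (h41 : StarredConwayDefectLaw) (h31 : ConwayFullOfIdentityComponentTorsion) :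
    TameConwayKodairaLaw := by
  intro W _ _ _ D hL hopt h2
  have h4 : 4 ∣ W.conductorNorm ℤ := by
    have h := pow_padicValNat_dvd (p := 2) (n := W.conductorNorm ℤ)
    rw [h2] at h; simpa using h
  rcases padicValRat_two_Δ_of_padicValNat_conductorNorm_eq_two W h2 with hΔ | hΔ
  · have hns : ¬ IsStarredAtTwo W := by unfold IsStarredAtTwo; rw [h2, hΔ]; norm_num
    have hnt : ¬ (IsTypeFourStarAtTwoTame W ∧ ¬ HasRationalTwoTorsion W) := by
      rintro ⟨⟨-, h8⟩, -⟩; rw [hΔ] at h8; norm_num at h8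
    rw [if_neg hnt, add_zero]; exact h40 W D hL hopt h4 hns
  · have hst : IsStarredAtTwo W := by unfold IsStarredAtTwo; rw [h2, hΔ]; norm_num
    have hn0 : ¬ IsTypeIZeroStarAtTwo W := by unfold IsTypeIZeroStarAtTwo; rw [h2, hΔ]; norm_num
    have htame : IsTypeFourStarAtTwoTame W := ⟨h2, hΔ⟩
    by_cases ht : HasRationalTwoTorsion W
    · have hnt : ¬ (IsTypeFourStarAtTwoTame W ∧ ¬ HasRationalTwoTorsion W) := fun hc => hc.2 ht
      rw [if_neg hnt, add_zero]; exact h31 W D hL hopt h4 (T2 W htame ht)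
    · rw [if_pos ⟨htame, ht⟩]; exact h41 W D hL hopt h4 hst hn0 ht

/-- The valuation typing meets Tate's algorithm: on a globally minimal model, `IsTypeFourStarAtTwoTame W` forces the Kodaira
SYMBOL IV* at the place `2` (`kodairaSymbolAt_of_four_dvd_conductorNorm`, Literature `TameAdditiveTypesAtTwoProofs`), hence
`IsExceptionalStarAtTwo W` — the four full-depth tame IV* curves of E-desc-38 are exactly E-desc-47's `E⁰`-torsion
exceptions. (PROVED.) [cite: SilvermanATAEC1994, IV.9.4 and Table 4.1] -/
theorem isExceptionalStarAtTwo_of_isTypeFourStarAtTwoTame (W : WeierstrassCurve ℚ) [W.IsElliptic]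
    [W.IsGloballyMinimal] (h : IsTypeFourStarAtTwoTame W) : IsExceptionalStarAtTwo W := by
  obtain ⟨h2, hΔ⟩ := h
  have hN : W.conductorNorm ℤ ≠ 0 := (conductorNorm_pos_holds W).ne'
  have h4 : 2 ^ 2 ∣ W.conductorNorm ℤ := by rw [padicValNat_dvd_iff_le hN]; omega
  have h8 : ¬ 2 ^ 3 ∣ W.conductorNorm ℤ := by rw [padicValNat_dvd_iff_le hN]; omega
  have hv : Rat.HeightOneSpectrum.natGenerator placeTwo = 2 :=
    congrArg Subtype.val
      ((Rat.HeightOneSpectrum.primesEquiv (R := ℤ)).apply_symm_apply ⟨2, Nat.prime_two⟩)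
  rw [← cast_minimalDiscriminantInt W, padicValRat.of_int] at hΔ
  rcases W.kodairaSymbolAt_of_four_dvd_conductorNorm placeTwo hv h4 h8 with ⟨-, h4'⟩ | ⟨hIV, -⟩
  · rw [h4'] at hΔ; norm_num at hΔ
  · exact Or.inl hIV

/-! ### §4. Consumers (desc g6 VERBATIM up to threading `h4`; PROVED) -/

/-- Bookkeeping: on the tame cell the Kodaira law implies the unstarred law (IV is unstarred, IV* is starred) —
`E-desc-38 ⇒ (E-desc-40 restricted to 4 ∥ N)`. (desc g6 VERBATIM, :293–304.) -/
theorem unstarred_full_of_tameKodairaLaw (h38 : TameConwayKodairaLaw)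
    (W : WeierstrassCurve ℚ) [W.IsElliptic] [W.IsGloballyMinimal] [NeZero (W.conductorNorm ℤ)]
    (D : ModularParametrizationData W (W.conductorNorm ℤ))
    (hL : ∀ z ∈ D.L.lattice, ∃ w ∈ periodLattice D.f, z = D.c * w)
    (hopt : ∀ (W' : WeierstrassCurve ℚ) [W'.IsElliptic]
        (D' : ModularParametrizationData W' (W.conductorNorm ℤ)),
        D'.f = D.f → D.modularDegree ≤ D'.modularDegree)
    (h2 : padicValNat 2 (W.conductorNorm ℤ) = 2) (hIV : ¬ IsTypeFourStarAtTwoTame W) :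
    padicValNat 2 (lineIndex (conwayStableLattice (W.conductorNorm ℤ)) D.f) = padicValNat 2 D.modularDegree := by
  have h := h38 W D hL hopt h2
  have hneg : ¬ (IsTypeFourStarAtTwoTame W ∧ ¬ HasRationalTwoTorsion W) := fun hc => hIV hc.1
  rw [if_neg hneg, add_zero] at h
  exact h

/-- The CHAIN for the UNSTARRED class (E-desc-40 + GIVEN + transfer ⇒ Manin at `2`): every optimal curve of Kodaira type
II, III or IV at `2` (with `4 ∣ N`) gets `2 ∤ c_E` with NO input from Cremona's tables — 178 of the 399 optimal newforms with
`4 ∣ N ≤ 612`. (desc g6 VERBATIM, :401–416, `h4` threaded into the landed `not_two_dvd_maninConstant_of_conwayDepth`.) -/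
theorem not_two_dvd_maninConstant_of_unstarred
    (hLaw : UnstarredConwayFullLaw) (hT : ConwayDepthTransfer)
    (W : WeierstrassCurve ℚ) [W.IsElliptic] [W.IsGloballyMinimal] [NeZero (W.conductorNorm ℤ)]
    (D : ModularParametrizationData W (W.conductorNorm ℤ)) (Δ : NeronFLineDatum W D)
    (hL : ∀ z ∈ D.L.lattice, ∃ w ∈ periodLattice D.f, z = D.c * w)
    (hopt : ∀ (W' : WeierstrassCurve ℚ) [W'.IsElliptic]
        (D' : ModularParametrizationData W' (W.conductorNorm ℤ)),
        D'.f = D.f → D.modularDegree ≤ D'.modularDegree)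
    (h4 : 4 ∣ W.conductorNorm ℤ) (hun : ¬ IsStarredAtTwo W)
    (hΛ : IsConwayNeronAtTwo Δ)
    (hfin : lineIndex (conwayStableLattice (W.conductorNorm ℤ)) D.f ≠ 0) :
    ¬ (2 : ℤ) ∣ D.maninConstant :=
  not_two_dvd_maninConstant_of_conwayDepth hT Δ h4 hΛ (hLaw W D hL hopt h4 hun) hfin

/-- The union of the two one-sided residual laws, as one statement (desc g6 addendum VERBATIM, :783–797; after the F2
repair: 64 of the 87 defect rows of the prose class; the complement — rank 0 and no Tamagawa excess — is the undecided
core). -/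
theorem residual_defect_of_rank_or_tamagawa
    (h44 : ResidualRankDefectLawAtTwo') (h46 : ResidualTamagawaDefectLawAtTwo)
    (W : WeierstrassCurve ℚ) [W.IsElliptic] [W.IsGloballyMinimal] [NeZero (W.conductorNorm ℤ)]
    (D : ModularParametrizationData W (W.conductorNorm ℤ))
    (hL : ∀ z ∈ D.L.lattice, ∃ w ∈ periodLattice D.f, z = D.c * w)
    (hopt : ∀ (W' : WeierstrassCurve ℚ) [W'.IsElliptic]
        (D' : ModularParametrizationData W' (W.conductorNorm ℤ)),
        D'.f = D.f → D.modularDegree ≤ D'.modularDegree)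
    (h4 : 4 ∣ W.conductorNorm ℤ) (hres : IsResidualAtTwo W)
    (hglob : 0 < W.mordellWeilRank ∨ padicValNat 2 W.torsionOrder < padicValNat 2 W.tamagawaProduct) :
    padicValNat 2 (lineIndex (conwayStableLattice (W.conductorNorm ℤ)) D.f) + 1 =
      padicValNat 2 D.modularDegree := by
  rcases hglob with hr | ht
  · exact h44 W D hL hopt h4 hres hr
  · exact h46 W D hL hopt h4 hres ht

/-! ### §5. Typing edges between the elementary predicates (refuter-1 `RefAudit65` RB65.1, PROVED) -/

/-- RB65.1b: typed tame IV* ⇒ typed starred and not typed I₀*. -/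
theorem isStarredAtTwo_not_IZero_of_isTypeFourStarAtTwoTame (W : WeierstrassCurve ℚ) (h : IsTypeFourStarAtTwoTame W) :
    IsStarredAtTwo W ∧ ¬ IsTypeIZeroStarAtTwo W := by
  obtain ⟨hN, hΔ⟩ := h
  unfold IsStarredAtTwo IsTypeIZeroStarAtTwo
  rw [hN, hΔ]; norm_num

/-- RB65.1c: the typed «2-torsion in `E⁰(ℚ₂)`» witness IS a rational 2-torsion point: `(2y + a₁x + a₃)² − 4·(equation)` is
the 2-division cubic `4x³ + b₂x² + 2b₄x + b₆`.  Hence E-desc-31 (needs it) and E-desc-41 (forbids rational 2-torsion) have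
disjoint hypotheses by construction, and the residual class excludes E-desc-31's class by its first clause. -/
theorem hasRationalTwoTorsion_of_hasTwoTorsionInIdentityComponentAtTwo (W : WeierstrassCurve ℚ)
    (h : HasTwoTorsionInIdentityComponentAtTwo W) : HasRationalTwoTorsion W := by
  obtain ⟨x, y, Fx, Fy, hE, h2, -, -, -⟩ := h
  refine ⟨x, ?_⟩
  rw [WeierstrassCurve.Affine.equation_iff] at hE
  simp only [WeierstrassCurve.twoTorsionPolynomial, Cubic.toPoly, Polynomial.eval_add, Polynomial.eval_mul,
    Polynomial.eval_C, Polynomial.eval_pow, Polynomial.eval_X, WeierstrassCurve.b₂, WeierstrassCurve.b₄,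
    WeierstrassCurve.b₆]
  linear_combination (-4 : ℚ) * hE + (2 * (y : ℚ) + W.a₁ * x + W.a₃) * h2

end LawsG6

end Summit.BirchSwinnertonDyer.Rank1Residual.ManinAdditive.ConwayCut

end
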